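import Summits.NavierStokesRegularity.NavierStokesRegularity.Theses.AxisymmetricExtremality
import Literature.Analysis.FluidPDE.HomSobolevWeakLimits
import Literature.Analysis.FluidPDE.SolenoidalL2Duality
import Literature.Analysis.FluidPDE.AxisymmetricEuler

/-!
# Route AxisymmetricExtremality — crux `MinimalDatumPFold` (stmt-NavierStokesRegularity-15452), stub `stub_liftAeToExact`

Registered stub of the line `registered` (`Cruxes/MinimalDatumPFold/Lines/birth.lean`, lead c1 reshape).
Target tree file: `Summits/NavierStokesRegularity/NavierStokesRegularity/Theorems/AxisymmetricExtremalityMinimalDatumPFoldAeToExact.lean`.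

From an a.e. `R`-equivariant Rusin–Šverák minimal blow-up datum `u₁` (`R = R_{2π/p}` the rotation
about the `x₂`-axis, `p ≥ 2`) to an exactly `R`-equivariant one: the bad set
`N = {x | u₁ (R x) ≠ R (u₁ x)}` is null, hence so is the union `Z = ⋃ₖ R^{-k} N` of its preimages
under the iterates of `R` (rotations preserve Lebesgue measure); `Z` is `R`-invariant because
`R^p = R_{2π} = id`. The field `u₂ = 𝟙_{Zᶜ} u₁` is exactly equivariant and agrees with `u₁` a.e.,
and every clause of `IsMinimalBlowupDatum` only sees the a.e. class of the datum (for the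
non-existence of a global Kato solution: reset the time-zero slice of a solution).
-/

set_option linter.dupNamespace false

noncomputable section

open MeasureTheory Set Function Filter Topology
open scoped ENNReal NNReal InnerProductSpace

namespace Summit.NavierStokesRegularity.NavierStokesRegularity.Theorems

open Literature.Analysis.FluidPDE Literature.Analysis.FunctionSpaces

/-- The duality-form global mild class only sees the a.e. classes of the slices and of the datum:
if `w t = u t` a.e. for every `t ≥ 0` and `w₀ = u₀` a.e., then a global unforced mild solution
`u` from `u₀` yields the global unforced mild solution `w` from `w₀` (every clause is an
`x`-integral of a slice; twin of `IsMildNSSolutionOn.congr_ae_Ico`). [folklore] -/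
theorem aeToExact_isGlobalMildSolution_congr_ae {ν : ℝ}
    {u w : ℝ → EuclideanSpace ℝ (Fin 3) → EuclideanSpace ℝ (Fin 3)}
    {u₀ w₀ : EuclideanSpace ℝ (Fin 3) → EuclideanSpace ℝ (Fin 3)}
    (h : IsGlobalMildSolution ν 0 u₀ u) (hw : ∀ t ∈ Ici (0 : ℝ), w t =ᵐ[volume] u t)
    (h₀ : w₀ =ᵐ[volume] u₀) : IsGlobalMildSolution ν 0 w₀ w := by
  refine ⟨fun t ht => (h.1 t ht).congr_ae (hw t ht).symm, fun t ht φ hφ hφd => ?_⟩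
  have key := h.2 t ht φ hφ hφd
  have e1 : ∫ x, ⟪w t x, φ x⟫_ℝ = ∫ x, ⟪u t x, φ x⟫_ℝ := by
    refine integral_congr_ae ?_
    filter_upwards [hw t ht] with x hx
    rw [hx]
  have e2 : ∫ x, ⟪w₀ x, heatTest ν φ t x⟫_ℝ = ∫ x, ⟪u₀ x, heatTest ν φ t x⟫_ℝ := by
    refine integral_congr_ae ?_
    filter_upwards [h₀] with x hx
    rw [hx]
  have e3 : (∫ τ in 0..t, ∫ x, ⟪w τ x, convect (w τ) (heatTest ν φ (t - τ)) x⟫_ℝ) =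
      ∫ τ in 0..t, ∫ x, ⟪u τ x, convect (u τ) (heatTest ν φ (t - τ)) x⟫_ℝ := by
    refine intervalIntegral.integral_congr fun τ hτ => ?_
    rw [uIcc_of_le (mem_Ici.1 ht)] at hτ
    have hτ' : τ ∈ Ici (0 : ℝ) := hτ.1
    refine integral_congr_ae ?_
    filter_upwards [hw τ hτ'] with x hx
    simp only [convect_apply, hx]
  rw [e1, e2, e3]
  exact key

/-- `C(S; Lᵖ)` only sees the slices up to null sets: if `w t = u t` a.e. for every `t ∈ S`, then
`w ∈ C(S; Lᵖ)` as soon as `u` is (twin of `ContinuousInLpOn.congr_ae_slices`). [folklore] -/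
theorem aeToExact_continuousInLpOn_congr_ae {S : Set ℝ} {q : ℝ≥0∞}
    {u w : ℝ → EuclideanSpace ℝ (Fin 3) → EuclideanSpace ℝ (Fin 3)}
    (hu : ContinuousInLpOn S q u) (h : ∀ t ∈ S, w t =ᵐ[volume] u t) :
    ContinuousInLpOn S q w := by
  refine ⟨fun t ht => (hu.1 t ht).ae_eq (h t ht).symm, fun t₀ ht₀ => ?_⟩
  refine (hu.2 t₀ ht₀).congr' ?_
  filter_upwards [self_mem_nhdsWithin] with t ht
  refine eLpNorm_congr_ae ?_
  filter_upwards [h t ht, h t₀ ht₀] with x h1 h2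
  simp only [Pi.sub_apply, h1, h2]

/-- Having a global Kato solution only depends on the a.e. class of the datum: given a global
Kato solution `u` of `u₀` and `v₀ = u₀` a.e., the field `u'` with `u' 0 = v₀` and `u' t = u t`
for `t ≠ 0` is a global Kato solution of `v₀` (all clauses are a.e.-invariant in each slice, and
the joint measurability is asked on `(0, ∞) × ℝ³` only). [folklore] -/
theorem aeToExact_hasGlobalKatoSolution_congr_ae {ν : ℝ}
    {u₀ v₀ : EuclideanSpace ℝ (Fin 3) → EuclideanSpace ℝ (Fin 3)}
    (hae : u₀ =ᵐ[volume] v₀) (h : HasGlobalKatoSolution ν u₀) : HasGlobalKatoSolution ν v₀ := by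
  classical
  obtain ⟨u, hmild, hcont, hu0, hmeas⟩ := h
  have hslice : ∀ t : ℝ, (if t = 0 then v₀ else u t) =ᵐ[volume] u t := by
    intro t
    by_cases ht : t = 0
    · subst ht
      rw [if_pos rfl, hu0]
      exact hae.symm
    · rw [if_neg ht]
  refine ⟨fun t => if t = 0 then v₀ else u t,
    aeToExact_isGlobalMildSolution_congr_ae hmild (fun t _ => hslice t) hae.symm,
    aeToExact_continuousInLpOn_congr_ae hcont (fun t _ => hslice t), if_pos rfl, ?_⟩
  refine hmeas.congr ?_
  filter_upwards [ae_restrict_mem (measurableSet_Ioi.prod MeasurableSet.univ)] with q hq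
  have hq1 : q.1 ≠ 0 := ne_of_gt hq.1
  simp only [Function.uncurry, if_neg hq1]

/-- Being a Rusin–Šverák minimal blow-up datum only depends on the a.e. class of the datum (with
the same representing class `g ∈ Ḣ^{1/2}`): `L³`-membership, `Represents`, weak
divergence-freeness and the (non-)existence of a global Kato solution are a.e.-invariant.
[folklore] -/
theorem aeToExact_isMinimalBlowupDatum_congr_ae {ν : ℝ}
    {u₁ u₂ : EuclideanSpace ℝ (Fin 3) → EuclideanSpace ℝ (Fin 3)}
    {g : HomSobolev (EuclideanSpace ℝ (Fin 3)) (EuclideanSpace ℂ (Fin 3)) (1 / 2 : ℝ)}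
    (hae : u₁ =ᵐ[volume] u₂) (h : IsMinimalBlowupDatum ν u₁ g) : IsMinimalBlowupDatum ν u₂ g := by
  obtain ⟨hL3, hrep, hdiv, hnorm, hnK⟩ := h
  exact ⟨hL3.ae_eq hae, hrep.congr_ae (hae.fun_comp EuclideanSpace.complexify), hdiv.congr_ae hae,
    hnorm, fun hK => hnK (aeToExact_hasGlobalKatoSolution_congr_ae hae.symm hK)⟩

/-- A full turn about the axis is the identity: `R_{2π} = id`. [folklore] -/
theorem aeToExact_rotZ_two_pi (x : EuclideanSpace ℝ (Fin 3)) : rotZ (2 * Real.pi) x = x := by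
  ext i
  fin_cases i <;> simp [Real.cos_two_pi, Real.sin_two_pi]

/-- **From a.e. to exact `p`-fold equivariance of a minimal blow-up datum.** Let `p ≥ 2`,
`θ = 2π/p`, `R = R_θ` the rotation about the `x₂`-axis (written out in coordinates), and let
`(u₁, g₁)` be a Rusin–Šverák minimal blow-up datum with `u₁ (R x) = R (u₁ x)` for a.e. `x`. Then
there is a minimal blow-up datum `(u₂, g₂)` with `u₂ (R x) = R (u₂ x)` for every `x`.
Proof: the bad set `N = {x | u₁ (R x) ≠ R (u₁ x)}` is null, hence so is `Z = ⋃ₖ (R^k)⁻¹ N`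
(`k ∈ ℕ`; rotations preserve Lebesgue measure), and `x ∈ Z ↔ R x ∈ Z` since `R^p = R_{2π} = id`.
Put `u₂ = u₁` off `Z` and `u₂ = 0` on `Z`, `g₂ = g₁`: off `Z` both `x, R x ∉ Z` and `x ∉ N`, so
`u₂ (R x) = u₁ (R x) = R (u₁ x) = R (u₂ x)`; on `Z` both sides vanish (`R 0 = 0`). Finally
`u₂ = u₁` a.e. and `IsMinimalBlowupDatum` is a.e.-invariant
(`aeToExact_isMinimalBlowupDatum_congr_ae`). [folklore] -/
theorem stub_liftAeToExact :
    ∀ (ν : ℝ) (p : ℕ), 2 ≤ p → ∀ (u₁ : EuclideanSpace ℝ (Fin 3) → EuclideanSpace ℝ (Fin 3)) (g₁ : Literature.Analysis.FunctionSpaces.HomSobolev (EuclideanSpace ℝ (Fin 3)) (EuclideanSpace ℂ (Fin 3)) (1 / 2 : ℝ)), Literature.Analysis.FluidPDE.IsMinimalBlowupDatum ν u₁ g₁ → (∀ᵐ x ∂(MeasureTheory.volume : MeasureTheory.Measure (EuclideanSpace ℝ (Fin 3))), u₁ (WithLp.toLp 2 ![Real.cos (2 * Real.pi / p) * x 0 -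 Real.sin (2 * Real.pi / p) * x 1, Real.sin (2 * Real.pi / p) * x 0 + Real.cos (2 * Real.pi / p) * x 1, x 2]) = WithLp.toLp 2 ![Real.cos (2 * Real.pi / p) * u₁ x 0 - Real.sin (2 * Real.pi / p) * u₁ x 1, Real.sin (2 * Real.pi / p) * u₁ x 0 + Real.cos (2 * Real.pi / p) * u₁ x 1, u₁ x 2]) → ∃ (u₂ : EuclideanSpace ℝ (Fin 3) → EuclideanSpace ℝ (Fin 3)) (g₂ : Literature.Analysis.FunctionSpaces.HomSobolev (EuclideanSpace ℝ (Fin 3)) (EuclideanSpace ℂ (Fin 3)) (1 / 2 : ℝ)), Literature.Analysis.FluidPDE.IsMinimalBlowupDatum ν u₂ g₂ ∧ ∀ x : EuclideanSpace ℝ (Fin 3), u₂ (WithLp.toLp 2 ![Real.cos (2 * Real.pi / p) * x 0 - Real.sin (2 * Real.pi / p) * x 1, Real.sin (2 * Real.pi / p) * x 0 + Real.cos (2 * Real.pi / p) * x 1, x 2]) = WithLp.toLp 2 ![Real.cos (2 * Real.pi / p) * u₂ x 0 - Real.sin (2 * Real.pi / p) * u₂ x 1, Real.sin (2 * Real.pi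 / p) * u₂ x 0 + Real.cos (2 * Real.pi / p) * u₂ x 1, u₂ x 2] := by
  classical
  intro ν p hp u₁ g₁ hmin hEq
  -- the angle and the a.e. equivariance in terms of `rotZ`
  set θ : ℝ := 2 * Real.pi / (p : ℝ) with hθ
  have hEq' : ∀ᵐ x ∂(volume : Measure (EuclideanSpace ℝ (Fin 3))),
      u₁ (rotZ θ x) = rotZ θ (u₁ x) := hEq
  have hp0 : (p : ℝ) ≠ 0 := Nat.cast_ne_zero.2 (by omega)
  have hpθ : (p : ℝ) * θ = 2 * Real.pi := by
    rw [hθ]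
    exact mul_div_cancel₀ _ hp0
  have hfull : ∀ x : EuclideanSpace ℝ (Fin 3), rotZ ((p : ℝ) * θ) x = x := fun x => by
    rw [hpθ]
    exact aeToExact_rotZ_two_pi x
  have hR0 : rotZ θ (0 : EuclideanSpace ℝ (Fin 3)) = 0 := by
    ext i
    fin_cases i <;> simp
  -- rotations about the axis preserve Lebesgue measure: `R_φ` is a linear isometry with inverse
  -- `R_{-φ}` (`rotZ_add`, `rotZ_zero`, `norm_rotZ`)
  have hmp : ∀ φ : ℝ,
      MeasurePreserving (rotZ φ) (volume : Measure (EuclideanSpace ℝ (Fin 3))) volume := by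
    intro φ
    exact LinearIsometryEquiv.measurePreserving
      ({ toFun := rotZ φ
         map_add' := fun v w => by
           ext i
           fin_cases i
           · simp only [Fin.zero_eta, Fin.isValue, rotZ_apply_zero, PiLp.add_apply]
             ring
           · simp only [Fin.mk_one, Fin.isValue, rotZ_apply_one, PiLp.add_apply]
             ring
           · simp only [Fin.reduceFinMk, Fin.isValue, rotZ_apply_two, PiLp.add_apply]
         map_smul' := fun c v => by
           ext i
           fin_cases i
           · simp only [Fin.zero_eta, Fin.isValue, rotZ_apply_zero, PiLp.smul_apply, smul_eq_mul,
               RingHom.id_apply]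
             ring
           · simp only [Fin.mk_one, Fin.isValue, rotZ_apply_one, PiLp.smul_apply, smul_eq_mul,
               RingHom.id_apply]
             ring
           · simp only [Fin.reduceFinMk, Fin.isValue, rotZ_apply_two, PiLp.smul_apply,
               smul_eq_mul, RingHom.id_apply]
         invFun := rotZ (-φ)
         left_inv := fun y => by
           show rotZ (-φ) (rotZ φ y) = y
           rw [← rotZ_add, neg_add_cancel, rotZ_zero]
         right_inv := fun y => by
           show rotZ φ (rotZ (-φ) y) = y
           rw [← rotZ_add, add_neg_cancel, rotZ_zero]
         norm_map' := norm_rotZ φ } : EuclideanSpace ℝ (Fin 3) ≃ₗᵢ[ℝ] EuclideanSpace ℝ (Fin 3))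
  -- the bad set and the union of its preimages under the iterates of the rotation
  obtain ⟨N, hNdef⟩ : ∃ N : Set (EuclideanSpace ℝ (Fin 3)),
      N = {x | ¬ u₁ (rotZ θ x) = rotZ θ (u₁ x)} := ⟨_, rfl⟩
  have hN0 : volume N = 0 := by
    rw [hNdef]
    exact ae_iff.1 hEq'
  obtain ⟨Z, hZdef⟩ : ∃ Z : Set (EuclideanSpace ℝ (Fin 3)),
      Z = ⋃ k : ℕ, (rotZ ((k : ℝ) * θ)) ⁻¹' N := ⟨_, rfl⟩
  have hZ0 : volume Z = 0 := by
    rw [hZdef]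
    exact measure_iUnion_null fun k =>
      (hmp ((k : ℝ) * θ)).quasiMeasurePreserving.preimage_null hN0
  have hZfwd : ∀ x, x ∈ Z → rotZ θ x ∈ Z := by
    intro x hx
    rw [hZdef, mem_iUnion] at hx ⊢
    obtain ⟨k, hk⟩ := hx
    refine ⟨k + (p - 1), ?_⟩
    rw [mem_preimage] at hk ⊢
    have hcast : ((k + (p - 1) : ℕ) : ℝ) + 1 = (k : ℝ) + p := by
      exact_mod_cast (show k + (p - 1) + 1 = k + p by omega)
    have h1 : ((k + (p - 1) : ℕ) : ℝ) * θ + θ = (k : ℝ) * θ + (p : ℝ) * θ := by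
      linear_combination θ * hcast
    rw [← rotZ_add, h1, rotZ_add, hfull]
    exact hk
  have hZbwd : ∀ x, rotZ θ x ∈ Z → x ∈ Z := by
    intro x hx
    rw [hZdef, mem_iUnion] at hx ⊢
    obtain ⟨k, hk⟩ := hx
    refine ⟨k + 1, ?_⟩
    rw [mem_preimage] at hk ⊢
    have h1 : ((k + 1 : ℕ) : ℝ) * θ = (k : ℝ) * θ + θ := by
      push_cast
      ring
    rw [h1, rotZ_add]
    exact hk
  have hNZ : ∀ x, x ∈ N → x ∈ Z := fun x hx => by
    rw [hZdef, mem_iUnion]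
    refine ⟨0, ?_⟩
    rw [mem_preimage, Nat.cast_zero, zero_mul, rotZ_zero]
    exact hx
  -- the modified field
  refine ⟨fun x => if x ∈ Z then 0 else u₁ x, g₁, ?_, fun x => ?_⟩
  · refine aeToExact_isMinimalBlowupDatum_congr_ae ?_ hmin
    filter_upwards [measure_eq_zero_iff_ae_notMem.1 hZ0] with x hx
    rw [if_neg hx]
  · change (if rotZ θ x ∈ Z then (0 : EuclideanSpace ℝ (Fin 3)) else u₁ (rotZ θ x)) =
      rotZ θ (if x ∈ Z then 0 else u₁ x)
    by_cases hx : x ∈ Z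
    · rw [if_pos (hZfwd x hx), if_pos hx, hR0]
    · rw [if_neg (fun h => hx (hZbwd x h)), if_neg hx]
      by_contra hne
      refine hx (hNZ x ?_)
      rw [hNdef]
      exact hne

end Summit.NavierStokesRegularity.NavierStokesRegularity.Theorems

end
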